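import Mathlib
import Summits.Ventures.FusionMHD.Models.CerfonFreidbergIterLikeQHalfShearDefs
import HarnessLib

/-!
# Ventures/FusionMHD — Models/CerfonFreidbergIterLikeQHalfShearPanels12.lean: KERNEL CHECK of the shear-register certificates of panels 22, 23 (of 32)
# at `ψ_N = 1/2` of THE Cerfon–Freidberg ITER-like instance

HONEST FRAMING (LADDER-GRIDFUSION three columns; CF rung; successor step of «q′(ψ_N = 1/2) on the CF rung», F2-SCOPING v1.6 §10(c)).  One `decide +kernel`
(≈ 80 s): for each listed panel the obligation `CFIterLike.QHalfShear.ShearCert.ok` (`Models/CerfonFreidbergIterLikeQHalfShearDefs.lean`) — the Taylor-model run of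
`progQ = CFIterLike.QHalf.progA ++ blockQ` over ★ #117's parameter box is ACCEPTED and the kernel's panel-integral enclosure of the shear kernel `K·p` along the
approximant lies inside the claimed integers (read off a compiled `#eval` of the same functions, slack one unit of `2⁻⁶⁰`; float truth inside every panel).
MODELLED: analytic Cerfon–Freidberg family; nothing about a device or stability.  No `native_decide`.  Typer/prover: gridfusion-model-5 (g8), 2026-08-27.
Citations: Freidberg 2014 §6.3.5 (6.35) [Freidberg2014]; Mahboubi–Melquiond–Sibut-Pinote 2016 §3.2 Lemma 3 [MahboubiMelquiondSibutpinote2016].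
-/

namespace Summit.Ventures.FusionMHD.Models.CFIterLike.QHalfShear

/-- Shear-register certificate data of panels 22, 23. [instance data] -/
def shearCert12 : List ShearCert := [
  { j := 22, cand := [2031168602596235542528, -9611877739688668168192, -12699519640848918642688, 502383215775496290697216, -2898307893849208104419328, 284921959784770487451648, 109989829522833843595247616, -767390678364198160599875584, 1123323987238545131376214016, 21071536078089759809385529344, -188166839274606404205356777472, 459550871679991347767142252544, 6181987795578104851818744905728],
    deg := 10, elog2 := 46, plo := 13089766656097494810, phi := 13089767779415803947 },
  { j := 23, cand := [1731053089240692031488, -9271159285405465968640, 18641350618719581110272, 187352864510902964060160, -1939066182653763500638208, 8473953375524915339329536, -2340213034597462581444608, -241294781508618583155933184, 1839996656742917764766760960, -6271659723907607572523253760, -5188427611844559596205113344, 300932953341633499680041074688, -6391472097718218835260172402688],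
    deg := 10, elog2 := 45, plo := 11488090308652750252, phi := 11488090937555355335 }]

/-- **KERNEL CHECK** of the shear register on panels 22, 23. -/
theorem shearCert12_ok : CFIterLike.QHalfShear.shearCert12.all ShearCert.ok = true := by
  decide +kernel

end Summit.Ventures.FusionMHD.Models.CFIterLike.QHalfShear
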